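import Literature.NumberTheory.Rogawski1990.TransferFactsCanonical                   -- ★ #77 `ArchTransfersExistCanonical`'s vocabulary: `IsQuotientOf`, `endoEmbArchCentralizer`, `archStableCentralizerEquiv`, (vi) `IsArchDeltaTransfer`
import Literature.NumberTheory.Automorphic.OrbitalMeasureQuotientOfPoint               -- ★ `IsQuotientOf.atPoint_eq_quotientMeasure` (a Weil-form family read at a point), `conjOut`, `out_conjClassesMk_eq_conj`
import Literature.NumberTheory.Automorphic.SingularOrbitalIntegralTransportWeilForm    -- ★ (G1) `integral_comp_conj_eq_measureReal_mul_classOrbitalIntegral_of_atPoint_eq` (compact centraliser: `∫_G f(xγx⁻¹) = ρ(Z)·Φ([γ])`)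
import Literature.NumberTheory.Rogawski1990.EndoscopicClassTransfer                    -- ★ `isConj_endoEmb_of_isStablyConjH`
import Literature.NumberTheory.Automorphic.LocalEndoscopicOrbitClosed                  -- ★ `isGRegular_of_isStablyConjH`
import Literature.NumberTheory.Automorphic.UnitaryGroupArchTopology                    -- ★ instances: `arch` locally compact, second countable, T₂
import HarnessLib

/-!
# (4.3.1) at `∞` in HAAR currency: for a thirteen-conjunct system the centraliser masses on the two sides of `Φ^st_H(γ_H, aH) = Σ Δ′_∞(γ_H, γ′) Φ(γ′, a′)`
# AGREE, so the identity holds verbatim for the full-group conjugation integrals `∫_{H_∞} aH(h γ_c h⁻¹) dν_H` and `∫_{G′_∞} a′(g γ′ g⁻¹) dν′`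
# at every `G`-regular `γ_H` with compact centraliser (Rogawski 1990 §1.7 «compatible measures», §4.3 (4.3.1); the (R3-f) entry lemma of (S-c))

Topic `NumberTheory/Rogawski1990`; namespaces `Literature.NumberTheory.Automorphic` (§1, generic) and `Literature.NumberTheory.Rogawski1990` (§2).  THEOREMS ONLY (no `def`,
no instance, no notation, no axiom, no named fact, no `sorry`).  Cell `pub/hodgecm-mathlib`, ENGINE T1 (crux H413 = `stmt-HodgeConjecture-24833`); ROAD-Sd residual R3
«(S-c) central vanishing» (`stub_ScCore` of `Cruxes/H413/Lines/F0_P3a_SdArch.lean`), brick (R3-f) step 1 «Haar-normalisation of (vi)» (census `CENSUS-R3-ScCentralVanishing`, bus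
2026-09-01T04:57Z MECHANISM NOTE); author F0P3a-p02 (g10).

WHY.  (S-c) is proved by running Harish-Chandra's limit formula (★ (R1G) ∕ ★ `ArchRankOneLimitFormulaPartial`) on the `H`-side of (vi) and flatness at a compact place on the
`G′`-side.  Both engines speak HAAR orbital integrals `∫_G f(xγx⁻¹) dν(x)`, while the letter's (vi) (`IsArchDeltaTransfer`) speaks CLASS orbital integrals `Φ([γ], f; m)` against the
Weil-form families `mH = dνH ∕ dtH`, `m′ = dν′ ∕ dt′` of a thirteen-conjunct system — whose centraliser measures `tH`, `t′` are ARBITRARY data subject only to the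
compatibilities (C) (stable invariance of `t` on the quasi-split `G_∞`), (C′G) (`t′ ↔ t` along ★ `archStableCentralizerEquiv`) and (C_H) (`tH ↦ t` along `ι_∞`).  At a `G`-regular
`γ_H` with compact centraliser, `∫_{H_∞} aH(h γ_c h⁻¹) dνH = tH(γ_c)(Z) · Φ([γ_c], aH; mH)` (★ (G1)) for every class `[γ_c]` of the stable class of `γ_H`, and likewise on `G′_∞`;
the point of this file is that ALL these masses are ONE number `φ(γ_H)` — `tH(out c)(Z) = t(ι out c)(Z) = t(ι out[γ_H])(Z) = tH(out[γ_H])(Z)` by (C_H), (C), (C_H), and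
`t′(out c′)(Z′) = t(ι out[γ_H])(Z)` by (C′G) whenever `Δ′_∞(γ_H, out c′) ≠ 0` — so (vi) multiplied by `φ(γ_H)` IS (vi) in Haar currency.  «Measures `dg` and `dg′` … are said to be
compatible if `dg = c|Ω|_v` and `dg′ = c|Ω′|_v` … the orbital integrals are defined using compatible measures on `H_{γ′}` and `G_γ`» (§1.7 p. 6, §4.3 p. 43).

WHAT IS PROVED.
§1 (generic locally compact group, ★ `IsQuotientOf` family): `measureReal_univ_map_of_measurable` (push-forwards preserve total mass),
   **`IsQuotientOf.integral_comp_conj_eq_measureReal_mul_classOrbitalIntegral`** — `∫_G f(xγx⁻¹) dν = t(out[γ])(univ) · Φ([γ], f; m)` at a `P`-class with compact `Z(γ)`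
   (★ `IsQuotientOf.atPoint_eq_quotientMeasure` + ★ (G1); the transported torus measure has the mass of `t (out [γ])`).
§2 (the letter's frame `(L, H′, T, ν′, νH, mH, m′, tH, t′, t)`): the mass lemmas `measureReal_univ_tH_out_eq_of_isArchStablyConjH`, `measureReal_univ_t'_out_eq_of_delta_ne_zero`, and
   **`finsum_integral_comp_conj_eq_finsum_delta_mul_integral_comp_conj_of_isArchDeltaTransfer`** — under (W_H) (W′) (C) (C′G) (C_H) (texts of ★ `ArchTransfersExistCanonical`
   VERBATIM, with the two `det ≠ 0` proofs as free binders), for `aH`, `a′` measurable with `IsArchDeltaTransfer L H′ T mH m′ aH a′` and a `G`-regular `γ_H` whose stable class and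
   norm-partners have compact centralisers:
   `∑ᶠ c ∈ {c | γ_H ∼st out c}, ∫_{H_∞} aH(h·out c·h⁻¹) dνH(h) = ∑ᶠ c′, T.Δ γ_H (out c′) · ∫_{G′_∞} a′(g·out c′·g⁻¹) dν′(g)`.
HONEST LABEL: HC_CM is proved only modulo the 7 printed citations until rung 0 closes; this file is measure bookkeeping inside the letter's system and pays nothing by itself.

## References
* [Rogawski1990] J. D. Rogawski, *Automorphic Representations of Unitary Groups in Three Variables*, Ann. of Math. Stud. 123 (1990), §1.7 p. 6; §4.3 (4.3.1) p. 43; §14.3 pp. 233–234;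
  §14.5 Lemma 14.5.2 (c) p. 238.
* [DeitmarEchterhoff2014] A. Deitmar, S. Echterhoff, *Principles of Harmonic Analysis*, 2nd ed. (2014), Thm. 1.5.3, Cor. 1.5.4 (Weil's formula; compact subgroups).
* [Folland1995] G. B. Folland, *A Course in Abstract Harmonic Analysis* (1995), §2.6 (2.52).
-/

set_option autoImplicit false

noncomputable section

open MeasureTheory Measure NumberField
open Literature.MeasureTheory.Group

/-! ## §1 Generic: a Weil-form family at a class with compact centraliser, in Haar currency -/

namespace Literature.NumberTheory.Automorphic

section Generic

/-- Push-forwards preserve total mass (`(e_* μ)(univ) = μ(univ)`, real-valued). [cite: DeitmarEchterhoff2014, Thm. 1.5.3] -/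
theorem measureReal_univ_map_of_measurable {X Y : Type*} [MeasurableSpace X] [MeasurableSpace Y] (μ : Measure X) {e : X → Y} (he : Measurable e) :
    (μ.map e).real Set.univ = μ.real Set.univ := by
  rw [measureReal_def, measureReal_def, Measure.map_apply he MeasurableSet.univ, Set.preimage_univ]

variable {G : Type*} [Group G] [TopologicalSpace G] [IsTopologicalGroup G] [LocallyCompactSpace G]
  [SecondCountableTopology G] [T2Space G] [MeasurableSpace G] [BorelSpace G]
  [∀ γ : G, MeasurableSpace (G ⧸ Subgroup.centralizer ({γ} : Set G))]
  [∀ γ : G, BorelSpace (G ⧸ Subgroup.centralizer ({γ} : Set G))]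

/-- **A WEIL-FORM FAMILY AT A CLASS WITH COMPACT CENTRALISER, IN HAAR CURRENCY**: if `m = dν ∕ dt` on the `P`-classes (★ `IsQuotientOf`), `P (out [γ])` and `Z(γ)` is compact,
then for measurable `f`: `∫_G f(x γ x⁻¹) dν(x) = t(out [γ])(Z(out [γ])) · Φ([γ], f; m)` (★ `IsQuotientOf.atPoint_eq_quotientMeasure`: `m.atPoint γ = dν ∕ d(transported t (out [γ]))`,
then ★ (G1); the transport along the conjugator preserves the mass).  Both sides use the same junk conventions for divergent integrals.
[cite: Rogawski1990, §1.7 p. 6; §4.3 (4.3.1) p. 43] [cite: DeitmarEchterhoff2014, Thm. 1.5.3, Cor. 1.5.4] [cite: Folland1995, §2.6 (2.52)] -/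
theorem OrbitalMeasureFamily.IsQuotientOf.integral_comp_conj_eq_measureReal_mul_classOrbitalIntegral
    {P : G → Prop} {ν : Measure G} [ν.IsHaarMeasure] [ν.IsMulRightInvariant]
    {t : ∀ γ : G, Measure (Subgroup.centralizer ({γ} : Set G))} {m : OrbitalMeasureFamily G}
    (h : m.IsQuotientOf P ν t) (γ : G) (hc : P (Quotient.out (ConjClasses.mk γ)))
    [CompactSpace (Subgroup.centralizer ({γ} : Set G))] {f : G → ℂ} (hf : Measurable f) :
    ∫ x, f (x * γ * x⁻¹) ∂ν =
      ((t (Quotient.out (ConjClasses.mk γ))).real Set.univ : ℂ) * classOrbitalIntegral m f (ConjClasses.mk γ) := by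
  obtain ⟨ti, hti, htii, hq, hti_eq⟩ := h.atPoint_eq_quotientMeasure γ hc
  haveI := hti
  haveI := htii
  haveI : SMulInvariantMeasure G (G ⧸ Subgroup.centralizer ({(Quotient.out (ConjClasses.mk γ) : G)} : Set G)) (m (ConjClasses.mk γ)) :=
    (h.isAdmissibleOn (ConjClasses.mk γ) hc).2.1
  rw [m.integral_comp_conj_eq_measureReal_mul_classOrbitalIntegral_of_atPoint_eq γ hq hf, hti_eq,
    measureReal_univ_map_of_measurable _ (Homeomorph.measurable _)]

end Generic

end Literature.NumberTheory.Automorphic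

/-! ## §2 The letter's frame: the masses agree across (vi), and (vi) in Haar currency -/

namespace Literature.NumberTheory.Rogawski1990

open Literature.NumberTheory.Automorphic Literature.NumberTheory.Automorphic.UnitaryGroup

section Arch

variable (L : Type) [Field L] [NumberField L] [IsCMField L] (H' : Matrix (Fin 3) (Fin 3) L)
  [MeasurableSpace (UnitaryGroup.arch (↥(maximalRealSubfield L)) L (IsCMField.complexConj L) 3 H')]
  [BorelSpace (UnitaryGroup.arch (↥(maximalRealSubfield L)) L (IsCMField.complexConj L) 3 H')]
  [MeasurableSpace (UnitaryGroup.arch (↥(maximalRealSubfield L)) L (IsCMField.complexConj L) 3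
    (Matrix.of fun i j : Fin 3 => if i.val + j.val + 1 = 3 then (1 : L) else 0))]
  [BorelSpace (UnitaryGroup.arch (↥(maximalRealSubfield L)) L (IsCMField.complexConj L) 3
    (Matrix.of fun i j : Fin 3 => if i.val + j.val + 1 = 3 then (1 : L) else 0))]
  [MeasurableSpace (UnitaryGroup.arch (↥(maximalRealSubfield L)) L (IsCMField.complexConj L) 2
          (Matrix.of fun i j : Fin 2 => if i.val + j.val + 1 = 2 then (1 : L) else 0) ×
        UnitaryGroup.arch (↥(maximalRealSubfield L)) L (IsCMField.complexConj L) 1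
          (Matrix.of fun i j : Fin 1 => if i.val + j.val + 1 = 1 then (1 : L) else 0))]
  [BorelSpace (UnitaryGroup.arch (↥(maximalRealSubfield L)) L (IsCMField.complexConj L) 2
          (Matrix.of fun i j : Fin 2 => if i.val + j.val + 1 = 2 then (1 : L) else 0) ×
        UnitaryGroup.arch (↥(maximalRealSubfield L)) L (IsCMField.complexConj L) 1
          (Matrix.of fun i j : Fin 1 => if i.val + j.val + 1 = 1 then (1 : L) else 0))]
  (tH : ∀ γH : UnitaryGroup.arch (↥(maximalRealSubfield L)) L (IsCMField.complexConj L) 2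
          (Matrix.of fun i j : Fin 2 => if i.val + j.val + 1 = 2 then (1 : L) else 0) ×
        UnitaryGroup.arch (↥(maximalRealSubfield L)) L (IsCMField.complexConj L) 1
          (Matrix.of fun i j : Fin 1 => if i.val + j.val + 1 = 1 then (1 : L) else 0),
    Measure (Subgroup.centralizer ({γH} : Set (UnitaryGroup.arch (↥(maximalRealSubfield L)) L (IsCMField.complexConj L) 2
          (Matrix.of fun i j : Fin 2 => if i.val + j.val + 1 = 2 then (1 : L) else 0) ×
        UnitaryGroup.arch (↥(maximalRealSubfield L)) L (IsCMField.complexConj L) 1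
          (Matrix.of fun i j : Fin 1 => if i.val + j.val + 1 = 1 then (1 : L) else 0)))))
  (t' : ∀ γ' : UnitaryGroup.arch (↥(maximalRealSubfield L)) L (IsCMField.complexConj L) 3 H',
    Measure (Subgroup.centralizer ({γ'} : Set (UnitaryGroup.arch (↥(maximalRealSubfield L)) L (IsCMField.complexConj L) 3 H'))))
  (t : ∀ γ : UnitaryGroup.arch (↥(maximalRealSubfield L)) L (IsCMField.complexConj L) 3
        (Matrix.of fun i j : Fin 3 => if i.val + j.val + 1 = 3 then (1 : L) else 0),
    Measure (Subgroup.centralizer ({γ} : Set (UnitaryGroup.arch (↥(maximalRealSubfield L)) L (IsCMField.complexConj L) 3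
        (Matrix.of fun i j : Fin 3 => if i.val + j.val + 1 = 3 then (1 : L) else 0)))))
  (hd' : H'.det ≠ 0) (hd₃ : (Matrix.of fun i j : Fin 3 => if i.val + j.val + 1 = 3 then (1 : L) else 0).det ≠ 0)
  -- (C): stable invariance of `t` on the quasi-split `G_∞` (conjunct 11 of ★ `ArchTransfersExistCanonical`'s system, its `det` proofs as the binder `hd₃`)
  (hC : ∀ (γ₁ γ₂ : UnitaryGroup.arch (↥(maximalRealSubfield L)) L (IsCMField.complexConj L) 3
        (Matrix.of fun i j : Fin 3 => if i.val + j.val + 1 = 3 then (1 : L) else 0))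
      (h₁ : IsRegularElt (γ₁.val : GL (Fin 3) (mixedEmbedding.mixedSpace L)))
      (hc : Corresponds (UnitaryGroup.conjMixed (↥(maximalRealSubfield L)) L (IsCMField.complexConj L))
        (UnitaryGroup.archFormOf L 3 (Matrix.of fun i j : Fin 3 => if i.val + j.val + 1 = 3 then (1 : L) else 0))
        (UnitaryGroup.archFormOf L 3 (Matrix.of fun i j : Fin 3 => if i.val + j.val + 1 = 3 then (1 : L) else 0)) γ₁ γ₂),
      Measure.map ⇑(UnitaryGroup.archStableCentralizerEquiv L hd₃ hd₃ hc h₁) (t γ₁) = t γ₂)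
  -- (C′G): `t′ ↔ t` across the inner twist (conjunct 12, `det` proofs as the binders `hd'`, `hd₃`)
  (hC'G : ∀ (γ' : UnitaryGroup.arch (↥(maximalRealSubfield L)) L (IsCMField.complexConj L) 3 H')
      (γ : UnitaryGroup.arch (↥(maximalRealSubfield L)) L (IsCMField.complexConj L) 3
        (Matrix.of fun i j : Fin 3 => if i.val + j.val + 1 = 3 then (1 : L) else 0))
      (h' : IsRegularElt (γ'.val : GL (Fin 3) (mixedEmbedding.mixedSpace L)))
      (hc : Corresponds (UnitaryGroup.conjMixed (↥(maximalRealSubfield L)) L (IsCMField.complexConj L))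
        (UnitaryGroup.archFormOf L 3 H')
        (UnitaryGroup.archFormOf L 3 (Matrix.of fun i j : Fin 3 => if i.val + j.val + 1 = 3 then (1 : L) else 0)) γ' γ),
      Measure.map ⇑(UnitaryGroup.archStableCentralizerEquiv L hd' hd₃ hc h') (t' γ') = t γ)
  -- (C_H): `tH ↦ t` along `ι_∞` (conjunct 13)
  (hCH : ∀ γH : UnitaryGroup.arch (↥(maximalRealSubfield L)) L (IsCMField.complexConj L) 2
          (Matrix.of fun i j : Fin 2 => if i.val + j.val + 1 = 2 then (1 : L) else 0) ×
        UnitaryGroup.arch (↥(maximalRealSubfield L)) L (IsCMField.complexConj L) 1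
          (Matrix.of fun i j : Fin 1 => if i.val + j.val + 1 = 1 then (1 : L) else 0),
      IsArchGRegular L γH → Measure.map ⇑(endoEmbArchCentralizer L γH) (tH γH) = t (endoEmbArch L γH))

/-! ### The masses on the `H`-side -/

include hC hCH in
/-- **THE `H`-SIDE MASSES ARE ONE NUMBER**: for a `G`-regular `γ_H` and any class `c` of its stable class, `tH(out [out c])(Z) = tH(out [γ_H])(Z)` — along (C_H) at both
representatives and (C) between the `ι_∞`-images (which are `GL₃(L ⊗ ℝ)`-conjugate: ★ `isConj_endoEmb_of_isStablyConjH`).  (`out [out c]` is the representative ★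
`IsQuotientOf.atPoint_eq_quotientMeasure` reads; it is `out c`.) [cite: Rogawski1990, §1.7 p. 6; §4.3 (4.3.1) p. 43] -/
theorem measureReal_univ_tH_out_eq_of_isArchStablyConjH
    (γH : UnitaryGroup.arch (↥(maximalRealSubfield L)) L (IsCMField.complexConj L) 2
          (Matrix.of fun i j : Fin 2 => if i.val + j.val + 1 = 2 then (1 : L) else 0) ×
        UnitaryGroup.arch (↥(maximalRealSubfield L)) L (IsCMField.complexConj L) 1
          (Matrix.of fun i j : Fin 1 => if i.val + j.val + 1 = 1 then (1 : L) else 0))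
    (hreg : IsArchGRegular L γH)
    (c : ConjClasses (UnitaryGroup.arch (↥(maximalRealSubfield L)) L (IsCMField.complexConj L) 2
          (Matrix.of fun i j : Fin 2 => if i.val + j.val + 1 = 2 then (1 : L) else 0) ×
        UnitaryGroup.arch (↥(maximalRealSubfield L)) L (IsCMField.complexConj L) 1
          (Matrix.of fun i j : Fin 1 => if i.val + j.val + 1 = 1 then (1 : L) else 0)))
    (hst : IsArchStablyConjH L γH (Quotient.out c)) :
    (tH (Quotient.out (ConjClasses.mk (Quotient.out c)))).real Set.univ = (tH (Quotient.out (ConjClasses.mk γH))).real Set.univ := by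
  -- conjugacy facts: `γH ∼ out [γH]`, `out c ∼ out [out c]`
  have hmk : ∀ x : UnitaryGroup.arch (↥(maximalRealSubfield L)) L (IsCMField.complexConj L) 2
          (Matrix.of fun i j : Fin 2 => if i.val + j.val + 1 = 2 then (1 : L) else 0) ×
        UnitaryGroup.arch (↥(maximalRealSubfield L)) L (IsCMField.complexConj L) 1
          (Matrix.of fun i j : Fin 1 => if i.val + j.val + 1 = 1 then (1 : L) else 0),
      IsConj x (Quotient.out (ConjClasses.mk x)) := fun x =>
    ConjClasses.mk_eq_mk_iff_isConj.1 (Quotient.out_eq (ConjClasses.mk x)).symm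
  have hst0 : IsArchStablyConjH L γH (Quotient.out (ConjClasses.mk γH)) := isStablyConjH_of_isConj (hmk γH)
  have hst1 : IsArchStablyConjH L γH (Quotient.out (ConjClasses.mk (Quotient.out c))) := hst.trans (isStablyConjH_of_isConj (hmk _))
  have hreg0 : IsArchGRegular L (Quotient.out (ConjClasses.mk γH)) := isGRegular_of_isStablyConjH _ _ _ _ hst0 hreg
  have hreg1 : IsArchGRegular L (Quotient.out (ConjClasses.mk (Quotient.out c))) := isGRegular_of_isStablyConjH _ _ _ _ hst1 hreg
  -- the `ι_∞`-images are `GL₃(L ⊗ ℝ)`-conjugate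
  have hcorr : Corresponds (UnitaryGroup.conjMixed (↥(maximalRealSubfield L)) L (IsCMField.complexConj L))
      (UnitaryGroup.archFormOf L 3 (Matrix.of fun i j : Fin 3 => if i.val + j.val + 1 = 3 then (1 : L) else 0))
      (UnitaryGroup.archFormOf L 3 (Matrix.of fun i j : Fin 3 => if i.val + j.val + 1 = 3 then (1 : L) else 0))
      (endoEmbArch L (Quotient.out (ConjClasses.mk γH))) (endoEmbArch L (Quotient.out (ConjClasses.mk (Quotient.out c)))) :=
    isConj_endoEmb_of_isStablyConjH (endoForm_archFormOf L) (hst0.symm.trans hst1)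
  -- masses: (C_H) at both representatives, (C) in between
  rw [← measureReal_univ_map_of_measurable (tH (Quotient.out (ConjClasses.mk (Quotient.out c))))
      (continuous_endoEmbArchCentralizer L (Quotient.out (ConjClasses.mk (Quotient.out c)))).measurable, hCH _ hreg1,
    ← measureReal_univ_map_of_measurable (tH (Quotient.out (ConjClasses.mk γH)))
      (continuous_endoEmbArchCentralizer L (Quotient.out (ConjClasses.mk γH))).measurable, hCH _ hreg0,
    ← hC _ _ hreg0 hcorr]
  exact measureReal_univ_map_of_measurable _ (map_continuous (UnitaryGroup.archStableCentralizerEquiv L hd₃ hd₃ hcorr hreg0)).measurable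

/-! ### The masses on the `G′`-side -/

include hC'G hCH in
/-- **THE `G′`-SIDE MASSES ARE THE SAME NUMBER**: for a `G`-regular `γ_H` and a class `c′` of `G′_∞` with `Δ′_∞(γ_H, out c′) ≠ 0` (so `ι_∞(γ_H) ↔ out c′`),
`t′(out [out c′])(Z′) = tH(out [γ_H])(Z)` — along (C′G) at `(out [out c′], ι_∞(out [γ_H]))` and (C_H) at `out [γ_H]`. [cite: Rogawski1990, §1.7 p. 6; §4.3 (4.3.1) p. 43; §14.3 pp. 233–234] -/
theorem measureReal_univ_t'_out_eq_of_delta_ne_zero (T : ArchTransferFactor L H')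
    (γH : UnitaryGroup.arch (↥(maximalRealSubfield L)) L (IsCMField.complexConj L) 2
          (Matrix.of fun i j : Fin 2 => if i.val + j.val + 1 = 2 then (1 : L) else 0) ×
        UnitaryGroup.arch (↥(maximalRealSubfield L)) L (IsCMField.complexConj L) 1
          (Matrix.of fun i j : Fin 1 => if i.val + j.val + 1 = 1 then (1 : L) else 0))
    (hreg : IsArchGRegular L γH)
    (c' : ConjClasses (UnitaryGroup.arch (↥(maximalRealSubfield L)) L (IsCMField.complexConj L) 3 H'))
    (hΔ : T.Δ γH (Quotient.out c') ≠ 0) :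
    (t' (Quotient.out (ConjClasses.mk (Quotient.out c')))).real Set.univ = (tH (Quotient.out (ConjClasses.mk γH))).real Set.univ := by
  -- `Δ ≠ 0` forces the norm-pair relation `ι_∞(γ_H) ↔ out c′`
  have hnp : IsArchNormPair L H' γH (Quotient.out c') := by
    by_contra hn
    exact hΔ (T.eq_zero_of_not_rel _ _ hn)
  have hmkH : IsConj γH (Quotient.out (ConjClasses.mk γH)) :=
    ConjClasses.mk_eq_mk_iff_isConj.1 (Quotient.out_eq (ConjClasses.mk γH)).symm
  have hmk' : IsConj (Quotient.out c') (Quotient.out (ConjClasses.mk (Quotient.out c'))) :=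
    ConjClasses.mk_eq_mk_iff_isConj.1 (Quotient.out_eq (ConjClasses.mk (Quotient.out c'))).symm
  have hst0 : IsArchStablyConjH L γH (Quotient.out (ConjClasses.mk γH)) := isStablyConjH_of_isConj hmkH
  have hreg0 : IsArchGRegular L (Quotient.out (ConjClasses.mk γH)) := isGRegular_of_isStablyConjH _ _ _ _ hst0 hreg
  -- `ι(out [γH]) ∼ ι(γH) ∼ out c′ ∼ out [out c′]` in `GL₃(L ⊗ ℝ)`
  have h1 : IsConj ((endoEmbArch L (Quotient.out (ConjClasses.mk γH))).val : GL (Fin 3) (mixedEmbedding.mixedSpace L))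
      ((endoEmbArch L γH).val : GL (Fin 3) (mixedEmbedding.mixedSpace L)) :=
    isConj_endoEmb_of_isStablyConjH (endoForm_archFormOf L) hst0.symm
  have h2 : IsConj ((endoEmbArch L γH).val : GL (Fin 3) (mixedEmbedding.mixedSpace L))
      ((Quotient.out c').val : GL (Fin 3) (mixedEmbedding.mixedSpace L)) := hnp
  have h3 : IsConj ((Quotient.out c').val : GL (Fin 3) (mixedEmbedding.mixedSpace L))
      ((Quotient.out (ConjClasses.mk (Quotient.out c'))).val : GL (Fin 3) (mixedEmbedding.mixedSpace L)) := by
    obtain ⟨u, hu⟩ := isConj_iff.1 hmk'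
    exact isConj_iff.2 ⟨(u.val : GL (Fin 3) (mixedEmbedding.mixedSpace L)), by rw [← hu]; rfl⟩
  have hreg' : IsRegularElt ((Quotient.out (ConjClasses.mk (Quotient.out c'))).val : GL (Fin 3) (mixedEmbedding.mixedSpace L)) :=
    isRegularElt_of_isConj (h1.trans (h2.trans h3)) hreg0
  have hcorr : Corresponds (UnitaryGroup.conjMixed (↥(maximalRealSubfield L)) L (IsCMField.complexConj L))
      (UnitaryGroup.archFormOf L 3 H')
      (UnitaryGroup.archFormOf L 3 (Matrix.of fun i j : Fin 3 => if i.val + j.val + 1 = 3 then (1 : L) else 0))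
      (Quotient.out (ConjClasses.mk (Quotient.out c'))) (endoEmbArch L (Quotient.out (ConjClasses.mk γH))) :=
    (h1.trans (h2.trans h3)).symm
  have e2 := congrArg (fun μ => Measure.real μ Set.univ) (hC'G _ _ hreg' hcorr)
  have e2' : (t' (Quotient.out (ConjClasses.mk (Quotient.out c')))).real Set.univ = (t (endoEmbArch L (Quotient.out (ConjClasses.mk γH)))).real Set.univ := by
    refine Eq.trans ?_ e2
    exact (measureReal_univ_map_of_measurable _ (map_continuous (UnitaryGroup.archStableCentralizerEquiv L hd' hd₃ hcorr hreg')).measurable).symm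
  rw [e2', ← measureReal_univ_map_of_measurable (tH (Quotient.out (ConjClasses.mk γH)))
      (continuous_endoEmbArchCentralizer L (Quotient.out (ConjClasses.mk γH))).measurable, hCH _ hreg0]

/-! ### (vi) in Haar currency -/

variable
  [∀ γ' : UnitaryGroup.arch (↥(maximalRealSubfield L)) L (IsCMField.complexConj L) 3 H',
    MeasurableSpace (UnitaryGroup.arch (↥(maximalRealSubfield L)) L (IsCMField.complexConj L) 3 H' ⧸
      Subgroup.centralizer ({γ'} : Set (UnitaryGroup.arch (↥(maximalRealSubfield L)) L (IsCMField.complexConj L) 3 H')))]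
  [∀ γ' : UnitaryGroup.arch (↥(maximalRealSubfield L)) L (IsCMField.complexConj L) 3 H',
    BorelSpace (UnitaryGroup.arch (↥(maximalRealSubfield L)) L (IsCMField.complexConj L) 3 H' ⧸
      Subgroup.centralizer ({γ'} : Set (UnitaryGroup.arch (↥(maximalRealSubfield L)) L (IsCMField.complexConj L) 3 H')))]
  [∀ a : (UnitaryGroup.arch (↥(maximalRealSubfield L)) L (IsCMField.complexConj L) 2
          (Matrix.of fun i j : Fin 2 => if i.val + j.val + 1 = 2 then (1 : L) else 0) ×
        UnitaryGroup.arch (↥(maximalRealSubfield L)) L (IsCMField.complexConj L) 1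
          (Matrix.of fun i j : Fin 1 => if i.val + j.val + 1 = 1 then (1 : L) else 0)),
    MeasurableSpace ((UnitaryGroup.arch (↥(maximalRealSubfield L)) L (IsCMField.complexConj L) 2
          (Matrix.of fun i j : Fin 2 => if i.val + j.val + 1 = 2 then (1 : L) else 0) ×
        UnitaryGroup.arch (↥(maximalRealSubfield L)) L (IsCMField.complexConj L) 1
          (Matrix.of fun i j : Fin 1 => if i.val + j.val + 1 = 1 then (1 : L) else 0)) ⧸
      Subgroup.centralizer ({a} : Set (UnitaryGroup.arch (↥(maximalRealSubfield L)) L (IsCMField.complexConj L) 2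
          (Matrix.of fun i j : Fin 2 => if i.val + j.val + 1 = 2 then (1 : L) else 0) ×
        UnitaryGroup.arch (↥(maximalRealSubfield L)) L (IsCMField.complexConj L) 1
          (Matrix.of fun i j : Fin 1 => if i.val + j.val + 1 = 1 then (1 : L) else 0))))]
  [∀ a : (UnitaryGroup.arch (↥(maximalRealSubfield L)) L (IsCMField.complexConj L) 2
          (Matrix.of fun i j : Fin 2 => if i.val + j.val + 1 = 2 then (1 : L) else 0) ×
        UnitaryGroup.arch (↥(maximalRealSubfield L)) L (IsCMField.complexConj L) 1
          (Matrix.of fun i j : Fin 1 => if i.val + j.val + 1 = 1 then (1 : L) else 0)),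
    BorelSpace ((UnitaryGroup.arch (↥(maximalRealSubfield L)) L (IsCMField.complexConj L) 2
          (Matrix.of fun i j : Fin 2 => if i.val + j.val + 1 = 2 then (1 : L) else 0) ×
        UnitaryGroup.arch (↥(maximalRealSubfield L)) L (IsCMField.complexConj L) 1
          (Matrix.of fun i j : Fin 1 => if i.val + j.val + 1 = 1 then (1 : L) else 0)) ⧸
      Subgroup.centralizer ({a} : Set (UnitaryGroup.arch (↥(maximalRealSubfield L)) L (IsCMField.complexConj L) 2
          (Matrix.of fun i j : Fin 2 => if i.val + j.val + 1 = 2 then (1 : L) else 0) ×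
        UnitaryGroup.arch (↥(maximalRealSubfield L)) L (IsCMField.complexConj L) 1
          (Matrix.of fun i j : Fin 1 => if i.val + j.val + 1 = 1 then (1 : L) else 0))))]


include hC hC'G hCH in
/-- **(4.3.1) AT `∞` IN HAAR CURRENCY.**  In a frame `(L, H′)` with Haar measures `νH` on `H_∞` and `ν′` on `G′_∞`, let `mH = dνH ∕ dtH` on the `G`-regular classes (W_H),
`m′ = dν′ ∕ dt′` on the regular classes (W′), with the compatibilities (C), (C′G), (C_H) of a thirteen-conjunct system; let `aH`, `a′` be measurable with `IsArchDeltaTransfer L H′ T mH m′ aH a′`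
((vi): `Φ^st_H(γ_H, aH) = Σ_{[γ′]} Δ′_∞(γ_H, γ′) Φ([γ′], a′)` at every `G`-regular `γ_H`).  Then at every `G`-regular `γ_H` whose stable class and whose norm-partners have compact
centralisers,  `∑ᶠ c ∈ {c | γ_H ∼st out c}, ∫_{H_∞} aH(h·out c·h⁻¹) dνH(h) = ∑ᶠ c′, T.Δ γ_H (out c′) · ∫_{G′_∞} a′(g·out c′·g⁻¹) dν′(g)`
— the relation with BOTH sides' orbital integrals taken against the Haar measures of the groups themselves (no `tH`, `t′`, `t` left): §1 at each class gives the factor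
`tH(·)(Z)` resp. `t′(·)(Z′)`, all equal to `φ = tH(out [γ_H])(Z) ≠ 0` by the two mass lemmas, and `φ · (vi)` is the claim (★ `mul_finsum_mem`, ★ `mul_finsum`).
[cite: Rogawski1990, §1.7 p. 6; §4.3 (4.3.1) p. 43; §14.3 pp. 233–234; §14.5 Lemma 14.5.2 (c) p. 238] [cite: DeitmarEchterhoff2014, Thm. 1.5.3, Cor. 1.5.4] -/
theorem finsum_integral_comp_conj_eq_finsum_delta_mul_integral_comp_conj_of_isArchDeltaTransfer (T : ArchTransferFactor L H')
    (ν' : Measure (UnitaryGroup.arch (↥(maximalRealSubfield L)) L (IsCMField.complexConj L) 3 H'))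
    (νH : Measure (UnitaryGroup.arch (↥(maximalRealSubfield L)) L (IsCMField.complexConj L) 2
            (Matrix.of fun i j : Fin 2 => if i.val + j.val + 1 = 2 then (1 : L) else 0) ×
          UnitaryGroup.arch (↥(maximalRealSubfield L)) L (IsCMField.complexConj L) 1
            (Matrix.of fun i j : Fin 1 => if i.val + j.val + 1 = 1 then (1 : L) else 0)))
    [ν'.IsHaarMeasure] [ν'.IsMulRightInvariant] [νH.IsHaarMeasure] [νH.IsMulRightInvariant]
    (mH : OrbitalMeasureFamily (UnitaryGroup.arch (↥(maximalRealSubfield L)) L (IsCMField.complexConj L) 2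
            (Matrix.of fun i j : Fin 2 => if i.val + j.val + 1 = 2 then (1 : L) else 0) ×
          UnitaryGroup.arch (↥(maximalRealSubfield L)) L (IsCMField.complexConj L) 1
            (Matrix.of fun i j : Fin 1 => if i.val + j.val + 1 = 1 then (1 : L) else 0)))
    (m' : OrbitalMeasureFamily (UnitaryGroup.arch (↥(maximalRealSubfield L)) L (IsCMField.complexConj L) 3 H'))
    -- (W_H), (W′)
    (hWH : mH.IsQuotientOf (IsArchGRegular L) νH tH)
    (hW' : m'.IsQuotientOf (fun γ => IsRegularElt (γ.val : GL (Fin 3) (mixedEmbedding.mixedSpace L))) ν' t')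
    -- the Δ-transfer pair
    (aH : (UnitaryGroup.arch (↥(maximalRealSubfield L)) L (IsCMField.complexConj L) 2 (Matrix.of fun i j : Fin 2 => if i.val + j.val + 1 = 2 then (1 : L) else 0) ×
          UnitaryGroup.arch (↥(maximalRealSubfield L)) L (IsCMField.complexConj L) 1 (Matrix.of fun i j : Fin 1 => if i.val + j.val + 1 = 1 then (1 : L) else 0)) → ℂ)
    (a' : UnitaryGroup.arch (↥(maximalRealSubfield L)) L (IsCMField.complexConj L) 3 H' → ℂ)
    (haH : Measurable aH) (ha' : Measurable a') (hδ : IsArchDeltaTransfer L H' T mH m' aH a')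
    -- the point
    (γH : UnitaryGroup.arch (↥(maximalRealSubfield L)) L (IsCMField.complexConj L) 2
          (Matrix.of fun i j : Fin 2 => if i.val + j.val + 1 = 2 then (1 : L) else 0) ×
        UnitaryGroup.arch (↥(maximalRealSubfield L)) L (IsCMField.complexConj L) 1
          (Matrix.of fun i j : Fin 1 => if i.val + j.val + 1 = 1 then (1 : L) else 0))
    (hreg : IsArchGRegular L γH)
    (hZH : ∀ a, IsArchStablyConjH L γH a → CompactSpace (Subgroup.centralizer ({a} : Set (UnitaryGroup.arch (↥(maximalRealSubfield L)) L (IsCMField.complexConj L) 2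
          (Matrix.of fun i j : Fin 2 => if i.val + j.val + 1 = 2 then (1 : L) else 0) ×
        UnitaryGroup.arch (↥(maximalRealSubfield L)) L (IsCMField.complexConj L) 1
          (Matrix.of fun i j : Fin 1 => if i.val + j.val + 1 = 1 then (1 : L) else 0)))))
    (hZ' : ∀ γ', IsArchNormPair L H' γH γ' → CompactSpace (Subgroup.centralizer ({γ'} : Set (UnitaryGroup.arch (↥(maximalRealSubfield L)) L (IsCMField.complexConj L) 3 H')))) :
    ∑ᶠ c ∈ {c : ConjClasses (UnitaryGroup.arch (↥(maximalRealSubfield L)) L (IsCMField.complexConj L) 2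
            (Matrix.of fun i j : Fin 2 => if i.val + j.val + 1 = 2 then (1 : L) else 0) ×
          UnitaryGroup.arch (↥(maximalRealSubfield L)) L (IsCMField.complexConj L) 1
            (Matrix.of fun i j : Fin 1 => if i.val + j.val + 1 = 1 then (1 : L) else 0)) | IsArchStablyConjH L γH (Quotient.out c)},
        ∫ h, aH (h * Quotient.out c * h⁻¹) ∂νH =
      ∑ᶠ c' : ConjClasses (UnitaryGroup.arch (↥(maximalRealSubfield L)) L (IsCMField.complexConj L) 3 H'),
        T.Δ γH (Quotient.out c') * ∫ g, a' (g * Quotient.out c' * g⁻¹) ∂ν' := by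
  -- the common mass `φ`
  have hmkH : IsConj γH (Quotient.out (ConjClasses.mk γH)) :=
    ConjClasses.mk_eq_mk_iff_isConj.1 (Quotient.out_eq (ConjClasses.mk γH)).symm
  have hst0 : IsArchStablyConjH L γH (Quotient.out (ConjClasses.mk γH)) := isStablyConjH_of_isConj hmkH
  have hreg0 : IsArchGRegular L (Quotient.out (ConjClasses.mk γH)) := isGRegular_of_isStablyConjH _ _ _ _ hst0 hreg
  obtain ⟨hH0, -, -⟩ := hWH (ConjClasses.mk γH) hreg0
  haveI := hZH _ hst0
  have hφ : ((tH (Quotient.out (ConjClasses.mk γH))).real Set.univ : ℂ) ≠ 0 := by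
    rw [Ne, Complex.ofReal_eq_zero, measureReal_def, ENNReal.toReal_eq_zero_iff, not_or]
    exact ⟨(isOpen_univ.measure_pos (tH (Quotient.out (ConjClasses.mk γH))) Set.univ_nonempty).ne', isCompact_univ.measure_lt_top.ne⟩
  -- (vi) at `γH`, multiplied by `φ`
  have hvi := congrArg (fun z : ℂ => ((tH (Quotient.out (ConjClasses.mk γH))).real Set.univ : ℂ) * z) (hδ γH hreg)
  beta_reduce at hvi
  rw [stableOrbitalIntegralRel_def, mul_finsum_mem, mul_finsum] at hvi
  -- LEFT: termwise `φ · Φ([out c], aH; mH) = ∫_{H_∞} aH(h·out c·h⁻¹) dνH`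
  have hL : ∀ c : ConjClasses (UnitaryGroup.arch (↥(maximalRealSubfield L)) L (IsCMField.complexConj L) 2
            (Matrix.of fun i j : Fin 2 => if i.val + j.val + 1 = 2 then (1 : L) else 0) ×
          UnitaryGroup.arch (↥(maximalRealSubfield L)) L (IsCMField.complexConj L) 1
            (Matrix.of fun i j : Fin 1 => if i.val + j.val + 1 = 1 then (1 : L) else 0)),
      c ∈ {c | IsArchStablyConjH L γH (Quotient.out c)} →
        ((tH (Quotient.out (ConjClasses.mk γH))).real Set.univ : ℂ) * classOrbitalIntegral mH aH c = ∫ h, aH (h * Quotient.out c * h⁻¹) ∂νH := by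
    intro c hc
    have hst : IsArchStablyConjH L γH (Quotient.out c) := hc
    have hc' : ConjClasses.mk (Quotient.out c) = c := Quotient.out_eq c
    have hregc : IsArchGRegular L (Quotient.out (ConjClasses.mk (Quotient.out c))) := by
      rw [hc']
      exact isGRegular_of_isStablyConjH _ _ _ _ hst hreg
    haveI := hZH _ hst
    have key := hWH.integral_comp_conj_eq_measureReal_mul_classOrbitalIntegral (Quotient.out c) hregc haH
    rw [measureReal_univ_tH_out_eq_of_isArchStablyConjH L tH t hd₃ hC hCH γH hreg c hst, hc'] at key
    exact key.symm
  -- RIGHT: termwise `φ · (Δ · Φ([out c′], a′; m′)) = Δ · ∫_{G′_∞} a′(g·out c′·g⁻¹) dν′`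
  have hR : ∀ c' : ConjClasses (UnitaryGroup.arch (↥(maximalRealSubfield L)) L (IsCMField.complexConj L) 3 H'),
      ((tH (Quotient.out (ConjClasses.mk γH))).real Set.univ : ℂ) * (T.Δ γH (Quotient.out c') * classOrbitalIntegral m' a' c') =
        T.Δ γH (Quotient.out c') * ∫ g, a' (g * Quotient.out c' * g⁻¹) ∂ν' := by
    intro c'
    by_cases hΔ : T.Δ γH (Quotient.out c') = 0
    · rw [hΔ, zero_mul, zero_mul, mul_zero]
    have hnp : IsArchNormPair L H' γH (Quotient.out c') := by
      by_contra hn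
      exact hΔ (T.eq_zero_of_not_rel _ _ hn)
    have hc' : ConjClasses.mk (Quotient.out c') = c' := Quotient.out_eq c'
    have hregc : IsRegularElt ((Quotient.out (ConjClasses.mk (Quotient.out c'))).val : GL (Fin 3) (mixedEmbedding.mixedSpace L)) := by
      rw [hc']
      exact isRegularElt_of_isConj hnp hreg
    haveI := hZ' _ hnp
    have key := hW'.integral_comp_conj_eq_measureReal_mul_classOrbitalIntegral (Quotient.out c') hregc ha'
    rw [measureReal_univ_t'_out_eq_of_delta_ne_zero L H' tH t' t hd' hd₃ hC'G hCH T γH hreg c' hΔ, hc'] at key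
    rw [key, mul_left_comm]
  have hL' := finsum_mem_congr rfl hL
  have hR' := finsum_congr hR
  exact hL'.symm.trans (hvi.trans hR')

end Arch

end Literature.NumberTheory.Rogawski1990

end
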